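import Summits.QuantumFields.YangMills.Theorems.UnitScaleTiltProp7OneFormCoshFamily
import Literature.MathematicalPhysics.QuantumFieldTheory.Balaban1983to89.B9Thm31GpAgmonDecayCoarseZd
import HarnessLib

/-!
# Route `UnitScaleTilt`, crux K1 «MinimiserStabilityRegPr» (stmt-QuantumFields-19200), EX face S45 — (L3′b), ONE-FORM STOREY, RATE-FLOOR:
# **THE COSH WEIGHT FAMILY AT AN EXPLICIT, K-FREE BLOCK RATE** — the fine rate `a := μ·η` (`0 < μ ≤ 1∕4`) is admissible, so the block rate is EXACTLY `μ`

Cell `ym3-torus` (HUMAN RULING D-0037; rung R3 = SU(2) YM₃ on T³ — NOT d = 4, NOT infinite volume, NOT a mass gap, NOT Clay).  Typed by `prover ym-line-cst-p1` g35 (FREE hands) on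
its own 08:51Z flag; `--supports stmt-QuantumFields-19200 --as helper`.  THEOREMS ONLY (0 `def`, 0 `sorry`, default heartbeats); count-neutral.

WHY.  V4b-1 ✓`Prop7MemberCoshWeight.exists_weight_rate` and O4b ✓`Prop7OneFormCoshFamily.exists_coshFamily` export the decay rate as a bare `∃ κ > 0` (`κ ≤ μ₀`); the witness
behind them (lit ✓`B9Eq342CoshWeightSite.exists_rate` at `t = ℓ = L^{K−n}`) is the fine rate `a = 1∕(24ℓ² + 4)`, i.e. the block rate `aℓ ≈ 1∕(24ℓ)`, which tends to `0` with `K`.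
The downstream knit (✓`pointwiseDecay_oneForm_knit`, E2E, K2) therefore displays `∃ κ₁ ∈ (0, r]` AFTER the member, and no K-free rate can be read off.  THIS FILE repairs the
root: for `0 < μ ≤ 1∕4` the fine rate `a := μη` satisfies the supersolution condition `1∕2 ≤ 1 − 2·3·η⁻²(cosh a − 1)` (lit ✓`B9Thm31GpAgmonDecayCoarseZd.cosh_sub_one_le_sq`: `cosh a − 1 ≤ a²` on `[0,1]`, so `6η⁻²·μ²η² = 6μ² ≤ 3∕8`),
and the cosh family of O4b at this `a` has block rate `aℓ = μ` EXACTLY — every clause of ✓`exists_coshFamily` with `κ := μ₀`, `μ₀` displayed BEFORE the member.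
WHAT IS PROVED (ns `Summit.QuantumFields.YangMills.Theorems.Prop7MemberCoshWeightRate`).
* §1 ★`weight_rate_explicit (hμ : 0 < μ) (hμ4 : μ ≤ 1∕4) : 0 < μη ∧ μη ≤ μη ∧ μη ≤ 1 ∧ 1∕2 ≤ 1 − 2·3·η⁻²(cosh(μη) − 1)`
  (the shape of ✓`exists_weight_rate`'s body at the explicit witness) · `rate_mul_pow_eq : μ·η·L^{K−n} = μ`.
* §2 ★★`coshFamily_of_rate (hnK) (ha0 : 0 < a) (hlam : 1∕2 ≤ 1 − 2·3·η⁻²(cosh a − 1)) (v)` — O4b's family at ANY admissible fine rate `a`, block rate `a·L^{K−n}` (O4b's proof verbatim,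
  the rate-choice line removed) · ★★★`exists_coshFamily_rate (hnK) (hμ₀ : 0 < μ₀) (hμ₀4 : μ₀ ≤ 1∕4) (v) : ∃ lam W, ⟨✓`exists_coshFamily`'s clauses with `κ := μ₀`⟩` — the K-FREE edition.
HONEST SCOPE.  Elementary; repairs a DISPLAY gap (no landed statement was false).  The `_rate` editions of the knit∕E2E∕K2 (`κ₁ := μ₀∕2` before the member) are one-line
re-derivations for their authors.  Nothing of the ten EX rows, `hT`, EX or the crux is proved here; no summit is proved by a helper.

References: T. Bałaban, CMP **99** (1985) 389–434 [Balaban1985BackgroundPropagators] (Thm 3.1 (3.42) p.397 «constants dependent on d and L only», (3.46) p.398);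
CMP **95** (1984) 17–40 [Balaban1984PropagatorsI] (Prop. 1.1 p.33, p.36).
-/

set_option autoImplicit false

noncomputable section

open scoped BigOperators

namespace Summit.QuantumFields.YangMills.Theorems.Prop7MemberCoshWeightRate

open Literature.MathematicalPhysics.QuantumFieldTheory.Balaban1983to89
open Literature.MathematicalPhysics.QuantumFieldTheory.Balaban1983to89.T3ContinuumYM3Torus
open T3SectALandauChart (eta eta_pos)
open B5Eq118OneStroke (iterBlockOf)
open B4Sect5Torus (TSite)
open B9SectCLatticeCarrier (Bond shift unshift)
open B4TorusKernel.MultiPeriod (circAbs)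
open B9Eq342CoshWeightSite (weight_site_pos weight_site_centre)
open B3Taylor310LocalRemainder (tdist_triangle)
open Summit.QuantumFields.YangMills.Theorems.Prop7SectET3Transport (periodsT3 siteEquiv bondEquiv bondEquiv_symm_apply)
open Summit.QuantumFields.YangMills.Theorems.Prop7BlockDistanceWeights (eta_mul_pow_eq_one)
open Summit.QuantumFields.YangMills.Theorems.Prop7MemberCoshWeight (weight_supersolution_member exp_blockDist_le_weight)
open Summit.QuantumFields.YangMills.Theorems.Prop7OneFormCoshFamily (bondEquiv_symm_src)
open B9Thm31GpAgmonDecayCoarseZd (cosh_sub_one_le_sq)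

variable (F : T3Family) (n K : ℕ)

/-! ## §1 The explicit fine rate `a := μη` -/

/-- ★ **THE EXPLICIT FINE RATE IS ADMISSIBLE**: for `0 < μ ≤ 1∕4`, `a := μ·η` satisfies `0 < a`, `a ≤ μη`, `a ≤ 1` and the supersolution condition
`1∕2 ≤ 1 − 2·3·η⁻²(cosh a − 1)` of ✓`Prop7MemberCoshWeight.weight_supersolution_member` — the body of ✓`exists_weight_rate` at a DISPLAYED witness
(`cosh a − 1 ≤ a² = μ²η²`, `η⁻²·η² = 1`, `6μ² ≤ 3∕8`). [cite: Balaban1985BackgroundPropagators, Thm 3.1 p.397; Balaban1984PropagatorsI, p.36] -/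
theorem weight_rate_explicit {μ : ℝ} (hμ : 0 < μ) (hμ4 : μ ≤ 1 / 4) :
    0 < μ * eta F n K ∧ μ * eta F n K ≤ μ * eta F n K ∧ μ * eta F n K ≤ 1 ∧
      (1 : ℝ) / 2 ≤ 1 - 2 * (3 : ℕ) * (eta F n K)⁻¹ ^ 2 * (Real.cosh (μ * eta F n K) - 1) := by
  have hη : 0 < eta F n K := eta_pos F n K
  have hηℓ : eta F n K * (F.L : ℝ) ^ (K - n) = 1 := eta_mul_pow_eq_one F (n := n) (K := K)
  have hL1 : (1 : ℝ) < (F.L : ℝ) := by exact_mod_cast F.hL.2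
  have hℓ1 : (1 : ℝ) ≤ (F.L : ℝ) ^ (K - n) := one_le_pow₀ hL1.le
  have hη1 : eta F n K ≤ 1 := by
    have : eta F n K * 1 ≤ eta F n K * (F.L : ℝ) ^ (K - n) := mul_le_mul_of_nonneg_left hℓ1 hη.le
    linarith
  have ha0 : 0 < μ * eta F n K := mul_pos hμ hη
  have ha1 : μ * eta F n K ≤ 1 := by nlinarith
  refine ⟨ha0, le_rfl, ha1, ?_⟩
  have hc : Real.cosh (μ * eta F n K) - 1 ≤ (μ * eta F n K) ^ 2 := cosh_sub_one_le_sq ha0.le ha1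
  have hkey : (eta F n K)⁻¹ ^ 2 * (Real.cosh (μ * eta F n K) - 1) ≤ μ ^ 2 := by
    calc (eta F n K)⁻¹ ^ 2 * (Real.cosh (μ * eta F n K) - 1) ≤ (eta F n K)⁻¹ ^ 2 * (μ * eta F n K) ^ 2 :=
          mul_le_mul_of_nonneg_left hc (by positivity)
      _ = μ ^ 2 := by field_simp
  have h6 : 2 * ((3 : ℕ) : ℝ) * ((eta F n K)⁻¹ ^ 2 * (Real.cosh (μ * eta F n K) - 1)) ≤ 2 * ((3 : ℕ) : ℝ) * μ ^ 2 :=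
    mul_le_mul_of_nonneg_left hkey (by positivity)
  have hμ2 : μ ^ 2 ≤ 1 / 16 := by nlinarith
  push_cast at h6 ⊢
  nlinarith

/-- Bookkeeping: the block rate of the explicit fine rate is `μ` exactly: `μ·η·L^{K−n} = μ`. [folklore] -/
theorem rate_mul_pow_eq (μ : ℝ) : μ * eta F n K * (F.L : ℝ) ^ (K - n) = μ := by
  rw [mul_assoc, eta_mul_pow_eq_one F (n := n) (K := K), mul_one]

/-! ## §2 The cosh family at an admissible fine rate, and the K-free edition -/

/-- ★★ **THE COSH FAMILY AT ANY ADMISSIBLE FINE RATE `a`** (`0 < a`, `1∕2 ≤ 1 − 2·3·η⁻²(cosh a − 1)`): O4b ✓`exists_coshFamily`'s family `W p₁ p = Π_μ cosh(a·circAbs_μ(p₁.1 − p.1))`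
with `λ := 1 − 2·3·η⁻²(cosh a − 1) ≥ 1∕2`, positive, normalised, a `λ`-supersolution of the flat `η⁻²`-stencil of the bond graph, with the FLOOR and GROWTH letters at the block rate
`κ := a·L^{K−n}` — O4b's proof with the rate-choice line removed. [cite: Balaban1984PropagatorsI, p.36, Prop. 1.1 p.33; Balaban1985BackgroundPropagators, Thm 3.1 (3.42) p.397] -/
theorem coshFamily_of_rate (hnK : n ≤ K) {a : ℝ} (ha0 : 0 < a) (hlam : (1 : ℝ) / 2 ≤ 1 - 2 * (3 : ℕ) * (eta F n K)⁻¹ ^ 2 * (Real.cosh a - 1))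
    (v : Site (F.P K) (K - n)) :
    ∃ (lam : ℝ) (W : Bond 3 (periodsT3 F K) → Bond 3 (periodsT3 F K) → ℝ),
      (1 : ℝ) / 2 ≤ lam ∧ (∀ p₁ p, 0 < W p₁ p) ∧
      (∀ p₁ p, lam * W p₁ p ≤ ∑ j : Fin 3 ⊕ Fin 3, (eta F n K)⁻¹ ^ 2 *
          (W p₁ p - W p₁ (Sum.elim (fun ν => unshift ν p.1) (fun ν => shift ν p.1) j, p.2)) + 1 * W p₁ p) ∧
      (∀ p₁, W p₁ p₁ = 1) ∧
      (∀ p₁ p, (1 / 8) * Real.exp (-(3 * (a * (F.L : ℝ) ^ (K - n)))) * Real.exp (a * (F.L : ℝ) ^ (K - n) *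
          (Site.tdist (iterBlockOf (K - n) ((bondEquiv F K).symm p₁).src) (iterBlockOf (K - n) ((bondEquiv F K).symm p).src) : ℝ)) ≤ W p₁ p) ∧
      (∀ κ' : ℝ, 0 ≤ κ' → κ' ≤ a * (F.L : ℝ) ^ (K - n) → ∀ p₁ p,
          Real.exp (κ' * (Site.tdist (iterBlockOf (K - n) ((bondEquiv F K).symm p₁).src) v : ℝ))
          ≤ (8 * Real.exp (3 * (a * (F.L : ℝ) ^ (K - n)))) * Real.exp (κ' * (Site.tdist (iterBlockOf (K - n) ((bondEquiv F K).symm p).src) v : ℝ)) * W p₁ p) := by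
  have hL1 : (1 : ℝ) < (F.L : ℝ) := by exact_mod_cast F.hL.2
  have hℓ : 0 < (F.L : ℝ) ^ (K - n) := pow_pos (by linarith) _
  refine ⟨1 - 2 * (3 : ℕ) * (eta F n K)⁻¹ ^ 2 * (Real.cosh a - 1),
    fun p₁ p => ∏ μ, Real.cosh (a * (circAbs (periodsT3 F K μ)
      (((((p₁.1 μ : ℕ) : ZMod (periodsT3 F K μ)) - ((p.1 μ : ℕ) : ZMod (periodsT3 F K μ))).val : ℕ) : ℤ) : ℝ)),
    hlam, fun p₁ p => weight_site_pos (periodsT3 F K) a p₁.1 p.1,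
    fun p₁ p => weight_supersolution_member F n K a p₁.1 p.1, fun p₁ => weight_site_centre (periodsT3 F K) a p₁.1, ?_, ?_⟩
  · -- the FLOOR: ✓`exp_blockDist_le_weight` read through `siteEquiv`
    intro p₁ p
    have hdom := exp_blockDist_le_weight F n K hnK ha0.le ((siteEquiv F K).symm p₁.1) ((siteEquiv F K).symm p.1)
    rw [show siteEquiv F K ((siteEquiv F K).symm p₁.1) = p₁.1 from (siteEquiv F K).apply_symm_apply _,
      show siteEquiv F K ((siteEquiv F K).symm p.1) = p.1 from (siteEquiv F K).apply_symm_apply _] at hdom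
    rw [bondEquiv_symm_src F K p₁, bondEquiv_symm_src F K p]
    exact hdom
  · intro κ' hκ'0 hκ'κ p₁ p
    set κ : ℝ := a * (F.L : ℝ) ^ (K - n) with hκ
    set x₁ : Site (F.P K) 0 := (siteEquiv F K).symm p₁.1 with hx₁
    set x : Site (F.P K) 0 := (siteEquiv F K).symm p.1 with hx
    have e₁ : ((bondEquiv F K).symm p₁).src = x₁ := bondEquiv_symm_src F K p₁
    have e : ((bondEquiv F K).symm p).src = x := bondEquiv_symm_src F K p
    rw [e₁, e]
    -- the weight dominates the block-distance exponential between the two bonds' blocks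
    have hdom := exp_blockDist_le_weight F n K hnK ha0.le x₁ x
    rw [show siteEquiv F K x₁ = p₁.1 from (siteEquiv F K).apply_symm_apply _,
      show siteEquiv F K x = p.1 from (siteEquiv F K).apply_symm_apply _] at hdom
    -- triangle inequality for the coarse distance
    have htri : (Site.tdist (iterBlockOf (K - n) x₁) v : ℝ)
        ≤ (Site.tdist (iterBlockOf (K - n) x₁) (iterBlockOf (K - n) x) : ℝ) + (Site.tdist (iterBlockOf (K - n) x) v : ℝ) := by
      exact_mod_cast tdist_triangle (iterBlockOf (K - n) x₁) (iterBlockOf (K - n) x) v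
    have hW0 := weight_site_pos (periodsT3 F K) a p₁.1 p.1
    have hd0 : (0 : ℝ) ≤ (Site.tdist (iterBlockOf (K - n) x₁) (iterBlockOf (K - n) x) : ℝ) := Nat.cast_nonneg _
    calc Real.exp (κ' * (Site.tdist (iterBlockOf (K - n) x₁) v : ℝ))
        ≤ Real.exp (κ * (Site.tdist (iterBlockOf (K - n) x₁) (iterBlockOf (K - n) x) : ℝ)) * Real.exp (κ' * (Site.tdist (iterBlockOf (K - n) x) v : ℝ)) := by
          rw [← Real.exp_add, Real.exp_le_exp]; nlinarith [mul_le_mul_of_nonneg_right hκ'κ hd0]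
      _ = (8 * Real.exp (3 * κ)) * Real.exp (κ' * (Site.tdist (iterBlockOf (K - n) x) v : ℝ))
            * ((1 / 8) * Real.exp (-(3 * (a * (F.L : ℝ) ^ (K - n)))) * Real.exp (a * (F.L : ℝ) ^ (K - n) * (Site.tdist (iterBlockOf (K - n) x₁) (iterBlockOf (K - n) x) : ℝ))) := by
          have h8 : Real.exp (3 * κ) * Real.exp (-(3 * (a * (F.L : ℝ) ^ (K - n)))) = 1 := by rw [← Real.exp_add, hκ, add_neg_cancel, Real.exp_zero]
          calc Real.exp (κ * (Site.tdist (iterBlockOf (K - n) x₁) (iterBlockOf (K - n) x) : ℝ)) * Real.exp (κ' * (Site.tdist (iterBlockOf (K - n) x) v : ℝ))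
              = Real.exp (κ * (Site.tdist (iterBlockOf (K - n) x₁) (iterBlockOf (K - n) x) : ℝ)) * Real.exp (κ' * (Site.tdist (iterBlockOf (K - n) x) v : ℝ))
                  * (Real.exp (3 * κ) * Real.exp (-(3 * (a * (F.L : ℝ) ^ (K - n))))) := by rw [h8, mul_one]
            _ = _ := by rw [hκ]; ring
      _ ≤ (8 * Real.exp (3 * κ)) * Real.exp (κ' * (Site.tdist (iterBlockOf (K - n) x) v : ℝ))
            * ∏ μ, Real.cosh (a * (circAbs (periodsT3 F K μ)
                (((((p₁.1 μ : ℕ) : ZMod (periodsT3 F K μ)) - ((p.1 μ : ℕ) : ZMod (periodsT3 F K μ))).val : ℕ) : ℤ) : ℝ)) :=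
          mul_le_mul_of_nonneg_left hdom (by positivity)

/-- ★★★ **THE COSH WEIGHT FAMILY AT THE K-FREE BLOCK RATE `μ₀`** (`0 < μ₀ ≤ 1∕4`, every source block `v`): a K-uniform `λ ≥ 1∕2` and a family `W p₁ ·` (positive, `W p₁ p₁ = 1`,
`λ`-supersolutions of the flat `η⁻²`-stencil of the bond graph — O3d's `hsup` VERBATIM) with the FLOOR `(1∕8)e^{−3μ₀}e^{μ₀·tdist(B p₁, B p)} ≤ W p₁ p` and the GROWTH letter
`e^{κ′·d p₁} ≤ (8e^{3μ₀})·e^{κ′·d p}·W p₁ p` for every `0 ≤ κ′ ≤ μ₀` — ✓`exists_coshFamily`'s clauses with `κ := μ₀` DISPLAYED (no `∃ κ`): the rate the knit∕E2E∕K2 can export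
BEFORE the member. [cite: Balaban1984PropagatorsI, p.36, Prop. 1.1 p.33; Balaban1985BackgroundPropagators, Thm 3.1 (3.42) p.397] -/
theorem exists_coshFamily_rate (hnK : n ≤ K) {μ₀ : ℝ} (hμ₀ : 0 < μ₀) (hμ₀4 : μ₀ ≤ 1 / 4) (v : Site (F.P K) (K - n)) :
    ∃ (lam : ℝ) (W : Bond 3 (periodsT3 F K) → Bond 3 (periodsT3 F K) → ℝ),
      (1 : ℝ) / 2 ≤ lam ∧ (∀ p₁ p, 0 < W p₁ p) ∧
      (∀ p₁ p, lam * W p₁ p ≤ ∑ j : Fin 3 ⊕ Fin 3, (eta F n K)⁻¹ ^ 2 *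
          (W p₁ p - W p₁ (Sum.elim (fun ν => unshift ν p.1) (fun ν => shift ν p.1) j, p.2)) + 1 * W p₁ p) ∧
      (∀ p₁, W p₁ p₁ = 1) ∧
      (∀ p₁ p, (1 / 8) * Real.exp (-(3 * μ₀)) * Real.exp (μ₀ * (Site.tdist (iterBlockOf (K - n) ((bondEquiv F K).symm p₁).src)
          (iterBlockOf (K - n) ((bondEquiv F K).symm p).src) : ℝ)) ≤ W p₁ p) ∧
      (∀ κ' : ℝ, 0 ≤ κ' → κ' ≤ μ₀ → ∀ p₁ p, Real.exp (κ' * (Site.tdist (iterBlockOf (K - n) ((bondEquiv F K).symm p₁).src) v : ℝ))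
          ≤ (8 * Real.exp (3 * μ₀)) * Real.exp (κ' * (Site.tdist (iterBlockOf (K - n) ((bondEquiv F K).symm p).src) v : ℝ)) * W p₁ p) := by
  obtain ⟨ha0, -, -, hlam⟩ := weight_rate_explicit F n K hμ₀ hμ₀4
  obtain ⟨lam, W, hlam', hpos, hsup, hW1, hfloor, hgrowth⟩ := coshFamily_of_rate F n K hnK ha0 hlam v
  rw [rate_mul_pow_eq F n K μ₀] at hfloor hgrowth
  exact ⟨lam, W, hlam', hpos, hsup, hW1, hfloor, hgrowth⟩

end Summit.QuantumFields.YangMills.Theorems.Prop7MemberCoshWeightRate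

end
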